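import Summits.QuantumAdvantage.QuantumAdvantage.Theorems.DigitRung.Negative.WalshAndIndependence
import Literature.NumberTheory.QuadraticFields.ThreeTorsionMean
import Literature.NumberTheory.QuadraticFields.ThreeTorsionMeanProofs
import Literature.NumberTheory.CubicFields.BinaryCubicForms

/-!
# `DigitRung` (stmt-QuantumAdvantage-15008, verbatim re-file of 2423) — line `Sketch`: reduction skeleton

Crux `Summit.QuantumAdvantage.QuantumAdvantage.Theses.ArithStatLadder.DigitRung` (route
`ArithStatLadder`, rank 2): for `t(D) = #Cl(ℚ(√D))[3]` and `𝒟_n` the `n`-bit `d` with `−d`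
fundamental, `Σ_{d ∈ 𝒟_n, bit_j d = b} (t(−d) − 2) = o(#𝒟_n)` uniformly in the position `j < n`.

The line (trunk common to all nine triaged idea cards; ideator-1 `Sketch.lean`: `FundDiscWeylSum`,
`CubicFieldWeylSum`), with `X = 2^n`:

* `stub_btt` — the vendored named fact `btt_threeTorsion_sum` itself (Bhargava–Taniguchi–Thorne 2023,
  Thm 1.2; in print, unproved in the tree): BLOCKED on that fact; the line is conditional on it.
* `stub_high` — the TOP digits `10j ≥ 7n` (and with them the block mean, `j = n − 1`): each half
  `{bit_j = b}` is a union of `2^{n−2−j}` intervals of length `2^j ≥ X^{7/10}`; difference the vendored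
  two-term asymptotic `btt_threeTorsion_sum` (Bhargava–Taniguchi–Thorne 2023, error `O(X^{2/3+ε})`)
  and the PROVED count `abs_card_negFundDiscrs_sub_le` over them. CONDITIONAL on that named fact.
* `stub_fourier` — exact finite Fourier expansion of the digit square wave `(−1)^{bit_j d}` on
  `ℤ/2^{j+1}`: supported on odd frequencies, L¹-mass `≤ A·(j+1)`.
* `stub_low` — bounded depths `k ≤ K₀` (digits `j < K₀`, any fixed `K₀`): the centred Weyl sums are
  `o(#𝒟_n)`, i.e. mean `2` in every class of `−d (mod 2^{K₀})` — bookkeeping from the route's support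
  item `EndJuntaRung` (stmt-QuantumAdvantage-2426) at level `K₀`, which enters `DigitRung_of` as a
  registered obligation.
* `stub_fundWeyl` — depths `5 ≤ k ≤ 7n/10 + 1`: the UNWEIGHTED Weyl sums over fundamental
  discriminants `k·‖Σ_{d ∈ 𝒟_n} e(d r/2^k)‖ ≤ ε·#𝒟_n` (no main term from `k = 5` on; Möbius +
  geometric sums; elementary).
* `stub_torsWeyl` — depths `K₀(ε) ≤ k ≤ 7n/10 + 1`: the `t`-WEIGHTED Weyl sums
  `k·‖Σ_{d ∈ 𝒟_n} t(−d) e(d r/2^k)‖ ≤ ε·#𝒟_n` — the OPEN middle band of the crux (cancellation in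
  `Σ_K e(r·Disc K/2^k)` over cubic fields / binary cubic forms), plus the low band
  `K₀ ≤ k ≤ (5/43)n` (in print only through Taniguchi–Thorne's twisted AP theorem, not in the tree).
* `stub_composition` — the composition itself, with the open input `stub_torsWeyl` as an explicit
  hypothesis (verbatim): `torsWeyl → btt_threeTorsion_sum → EndJuntaRung → Concl quadFieldThreeTorsion`
  (`= DigitRung` by `Negative.digitRung_iff_canonical`, the `∀ t` being bookkeeping), through
  `Negative.concl_iff_total_and_walsh` (digit halves ⇔ block mean + weight-one Walsh sums):
  `walsh(n, j) = Σ_r c_r · weylSum n (j+1) r`, so `|walsh| ≤ A(j+1)·max_{r odd} ‖weylSum‖ ≤ A·ε·#𝒟_n`.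
  Proved sorry-free from `stub_low`, `stub_high`, `stub_fourier`, `stub_fundWeyl` in
  `Theorems/ArithStatLadderDigitRungComposition.lean` (this session); the proof is kept below as well.
* `DigitRung_of` — `digitRung_iff_canonical.mpr (stub_composition stub_torsWeyl stub_btt hEJ)`.

Status (2026-08-16, prover-pitem-15008-0): landed `stub_low` (p88101), `stub_high` (p88316, conditional
on the named fact), helpers of `stub_fundWeyl` (p88409); proved this session `stub_fourier`,
`stub_fundWeyl`, `stub_composition`; OPEN: `stub_torsWeyl` (the middle band, not in print); by design:
`stub_btt` = the named fact.
-/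

noncomputable section

namespace Summit.QuantumAdvantage.DigitRung.Sketch

open scoped Classical FourierTransform
open Filter Finset
open Literature.NumberTheory.QuadraticFields
open Summit.QuantumAdvantage.DigitRung.Negative
open Summit.QuantumAdvantage.QuantumAdvantage.Theses.ArithStatLadder (DigitRung EndJuntaRung)
open Literature.NumberTheory.CubicFields (BinaryCubic)

/-! ### Weyl sums over the block `𝒟_n` at dyadic frequencies `r/2^k` (written out in full)

Three sums recur below, always literally (no definitions, so that every stub is self-contained):
* `F(n,k,r) = Σ_{d ∈ 𝒟_n} e(d·r/2^k)` — unweighted, over the `n`-bit `d` with `−d` fundamental;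
* `T(n,k,r) = Σ_{d ∈ 𝒟_n} t(−d)·e(d·r/2^k)`, `t = quadFieldThreeTorsion = #Cl₃` — `3`-torsion-weighted;
* `W(n,k,r) = Σ_{d ∈ 𝒟_n} (t(−d) − 2)·e(d·r/2^k) = T − 2F` — centred.
Here `e(x) = 𝐞 x = exp(2πix)` (`Real.fourierChar`, coerced to `ℂ`) and `𝒟_n = Negative.block n`. -/

/-- `W = T − 2F`. [folklore] -/
theorem weylSum_eq (n k r : ℕ) :
    (∑ d ∈ block n, ((quadFieldThreeTorsion (-(d:ℤ)) : ℂ) - 2) *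
        (𝐞 ((d : ℝ) * ((r : ℝ) / 2 ^ k)) : ℂ)) =
      (∑ d ∈ block n, (quadFieldThreeTorsion (-(d:ℤ)) : ℂ) * (𝐞 ((d : ℝ) * ((r : ℝ) / 2 ^ k)) : ℂ)) -
        2 * ∑ d ∈ block n, (𝐞 ((d : ℝ) * ((r : ℝ) / 2 ^ k)) : ℂ) := by
  rw [Finset.mul_sum, ← Finset.sum_sub_distrib]
  refine Finset.sum_congr rfl fun d _ => ?_
  ring

/-! ### The stubs -/

/-- **Stub (the vendored named fact).** Bhargava–Taniguchi–Thorne 2023, Thm 1.2, as vendored in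
`Literature/NumberTheory/QuadraticFields/ThreeTorsionMean.lean` (a `def … : Prop`, in print, not
proved in the tree): the only Davenport–Heilbronn-type input of the line. Any proof of the crux proves
the dyadic Davenport–Heilbronn mean (`Negative.digitRung_implies_dyadicMeanTwo`), so an input of this
kind is unavoidable; this stub is BLOCKED on the named fact, not provable inside the line. -/
theorem stub_btt : btt_threeTorsion_sum := by
  sorry

/-- **Stub (top digits).** From the Bhargava–Taniguchi–Thorne two-term asymptotic: at the positions
`j` with `7n ≤ 10j` every digit half has centred sum `≤ ε·#𝒟_n` eventually. -/
theorem stub_high (hbtt : btt_threeTorsion_sum) :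
    ∀ ε : ℝ, 0 < ε → ∀ᶠ n : ℕ in atTop, ∀ j < n, 7 * n ≤ 10 * j → ∀ b : Bool,
      |dev quadFieldThreeTorsion n j b| ≤ ε * ((block n).card : ℝ) := by
  sorry

/-- **Stub (square-wave Fourier expansion).** There is an absolute `A` such that for every `j` the
digit sign `(−1)^{bit_j d}` is a linear combination of the characters `d ↦ e(d·r/2^{j+1})`, `r` odd,
`r < 2^{j+1}`, with coefficients of total mass `≤ A·(j+1)`. -/
theorem stub_fourier :
    ∃ A : ℝ, ∀ j : ℕ, ∃ c : ℕ → ℂ,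
      (∑ r ∈ Finset.range (2 ^ (j + 1)), ‖c r‖) ≤ A * (j + 1) ∧
      (∀ r, ¬ Odd r → c r = 0) ∧
      ∀ d : ℕ, ((walshSign j d : ℝ) : ℂ) =
        ∑ r ∈ Finset.range (2 ^ (j + 1)), c r * (𝐞 ((d : ℝ) * ((r : ℝ) / 2 ^ (j + 1))) : ℂ) := by
  sorry

/-- **Stub (bounded depths `k ≤ K₀`).** For every fixed `K₀`, the centred Weyl sums at odd `r/2^k`,
`1 ≤ k ≤ K₀`, are `o(#𝒟_n)`: the mean of `#Cl₃(−d)` is `2` in every class of `d (mod 2^{K₀})` met by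
fundamental `−d`. Bookkeeping from the route's support item `EndJuntaRung` (stmt-QuantumAdvantage-2426,
in print modulo a Davenport–Heilbronn-with-congruences named fact) at level `K₀`: a class mod `2^{K₀}`
inside `𝒟_n` is the disjoint union of the `2^{K₀}` end-cylinders fixing the `K₀` lowest and `K₀`
highest bits. -/
theorem stub_low (hEJ : EndJuntaRung) :
    ∀ K₀ : ℕ, ∀ ε : ℝ, 0 < ε → ∀ᶠ n : ℕ in atTop, ∀ k r : ℕ, 1 ≤ k → k ≤ K₀ → Odd r → r < 2 ^ k →
      ‖∑ d ∈ block n, ((quadFieldThreeTorsion (-(d:ℤ)) : ℂ) - 2) *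
          (𝐞 ((d : ℝ) * ((r : ℝ) / 2 ^ k)) : ℂ)‖ ≤ ε * ((block n).card : ℝ) := by
  sorry

/-- **Stub (unweighted Weyl sums over fundamental discriminants, depths `5 ≤ k ≤ 7n/10 + 1`).**
`k·‖Σ_{d ∈ 𝒟_n} e(d r/2^k)‖ ≤ ε·#𝒟_n` for odd `r`, eventually in `n`. -/
theorem stub_fundWeyl :
    ∀ ε : ℝ, 0 < ε → ∀ᶠ n : ℕ in atTop, ∀ k r : ℕ, 5 ≤ k → 10 * k ≤ 7 * n + 10 → Odd r →
      r < 2 ^ k →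
      (k : ℝ) * ‖∑ d ∈ block n, (𝐞 ((d : ℝ) * ((r : ℝ) / 2 ^ k)) : ℂ)‖ ≤ ε * ((block n).card : ℝ) := by
  sorry

/-- **Stub (`3`-torsion-weighted Weyl sums, depths `K₀(ε) ≤ k ≤ 7n/10 + 1`; the open middle band).**
`k·‖Σ_{d ∈ 𝒟_n} #Cl₃(−d)·e(d r/2^k)‖ ≤ ε·#𝒟_n` for odd `r`, from some depth `K₀(ε)` on, eventually in
`n` (boundedly many small depths may be discarded: they are `stub_low`'s). -/
theorem stub_torsWeyl :
    ∀ ε : ℝ, 0 < ε → ∃ K₀ : ℕ, ∀ᶠ n : ℕ in atTop, ∀ k r : ℕ, K₀ ≤ k → 10 * k ≤ 7 * n + 10 →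
      Odd r → r < 2 ^ k →
      (k : ℝ) * ‖∑ d ∈ block n, (quadFieldThreeTorsion (-(d:ℤ)) : ℂ) *
          (𝐞 ((d : ℝ) * ((r : ℝ) / 2 ^ k)) : ℂ)‖ ≤ ε * ((block n).card : ℝ) := by
  sorry

/-- **Stub (first lemma of `stub_torsWeyl`'s line — the `c`-fibre Weyl bound at dyadic frequencies).**
Along the line `circle-uniform-fibre-weyl` ≈ `fibred-weyl-middle-coefficient` (both triagers), the
weighted Weyl sum becomes, after the Davenport–Heilbronn/BST reduction, a sum of `e(r·Disc(f)/2^k)`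
over integral binary cubic forms `f = (a,b,c,d)` in a fundamental region; along each `c`-fibre the
phase is a real cubic in `c` with `X³`-coefficient `−4a·r/2^k = −a'r/2^{k−2−v}` (`a = 2^v a'`, `a'`
odd), so the tree's Weyl estimate (`Teravainen2024.weyl_topCoeff`, Green–Tao L4.4) gives `< δL` on
every `c`-interval of length `L` as soon as `K(δ) < 2^{k−2−v} < L³/K(δ)`, uniformly in the odd `r`
("dyadic frequencies are never major"). Not consumed by `DigitRung_of` (the reduction to fibres is the
open part); registered so that it lands as a support. PROVED this session
(`Theorems/ArithStatLadderDigitRungStubFibreWeyl.lean`). -/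
theorem stub_fibreWeyl :
    ∃ (A : ℕ) (C : ℝ), 1 ≤ C ∧
      ∀ (δ : ℝ) (c₀ : ℤ) (L : ℕ) (a' b d : ℤ) (v k r : ℕ), 0 < δ → δ ≤ 1 → 1 ≤ L → Odd a' →
        Odd r → v + 2 ≤ k →
        C * (8 / δ ^ 2) ^ A < (2 : ℝ) ^ (k - 2 - v) →
        (2 : ℝ) ^ (k - 2 - v) * (C * (8 / δ ^ 2) ^ A) < (L : ℝ) ^ 3 →
        ‖∑ c ∈ Finset.Ioc c₀ (c₀ + L),
            (𝐞 (((r : ℝ) / 2 ^ k) * (((⟨2 ^ v * a', b, c, d⟩ : BinaryCubic ℤ).disc : ℤ) : ℝ)) : ℂ)‖ <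
          δ * L := by
  sorry

/-- **Stub (composition).** `DigitRung` in its canonical form `Concl quadFieldThreeTorsion`
(`digitRung_iff_canonical`) from the weighted Weyl-sum input (the statement of `stub_torsWeyl`,
verbatim, as a hypothesis), the named fact `btt_threeTorsion_sum` and the route's support item
`EndJuntaRung`. Proved below modulo the other stubs (`DigitRung_of'`), and sorry-free in
`Theorems/ArithStatLadderDigitRungComposition.lean` once `stub_fourier`/`stub_fundWeyl` land. -/
theorem stub_composition
    (hT : ∀ ε : ℝ, 0 < ε → ∃ K₀ : ℕ, ∀ᶠ n : ℕ in atTop, ∀ k r : ℕ, K₀ ≤ k → 10 * k ≤ 7 * n + 10 →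
      Odd r → r < 2 ^ k →
      (k : ℝ) * ‖∑ d ∈ block n, (quadFieldThreeTorsion (-(d:ℤ)) : ℂ) *
          (𝐞 ((d : ℝ) * ((r : ℝ) / 2 ^ k)) : ℂ)‖ ≤ ε * ((block n).card : ℝ))
    (hbtt : btt_threeTorsion_sum) (hEJ : EndJuntaRung) : Concl quadFieldThreeTorsion := by
  sorry

/-- **Composition (registered form).** -/
theorem DigitRung_of (hEJ : EndJuntaRung) : DigitRung :=
  digitRung_iff_canonical.mpr (stub_composition stub_torsWeyl stub_btt hEJ)

/-! ### Composition, written out (this is the content of `stub_composition`) -/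

/-- The centred Weyl input at all depths `1 ≤ k ≤ 7n/10 + 1`, assembled from `stub_low`,
`stub_fundWeyl`, `stub_torsWeyl`. [folklore] -/
theorem weyl_input (hEJ : EndJuntaRung) :
    ∀ ε : ℝ, 0 < ε → ∀ᶠ n : ℕ in atTop, ∀ k r : ℕ, 1 ≤ k → 10 * k ≤ 7 * n + 10 → Odd r →
      r < 2 ^ k →
      (k : ℝ) * ‖∑ d ∈ block n, ((quadFieldThreeTorsion (-(d:ℤ)) : ℂ) - 2) *
          (𝐞 ((d : ℝ) * ((r : ℝ) / 2 ^ k)) : ℂ)‖ ≤ ε * ((block n).card : ℝ) := by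
  intro ε hε
  obtain ⟨K₀, hK₀⟩ := stub_torsWeyl (ε / 3) (by positivity)
  set K : ℕ := max K₀ 5 with hKdef
  have hK1 : (1 : ℝ) ≤ K := by exact_mod_cast (le_max_right K₀ 5).trans' (by norm_num)
  have hKpos : (0 : ℝ) < K := by linarith
  filter_upwards [stub_low hEJ K (ε / K) (by positivity), stub_fundWeyl (ε / 3) (by positivity),
    hK₀] with n hL hF hT k r hk1 hkn hro hr
  set F : ℂ := ∑ d ∈ block n, (𝐞 ((d : ℝ) * ((r : ℝ) / 2 ^ k)) : ℂ) with hFdef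
  set T : ℂ := ∑ d ∈ block n, (quadFieldThreeTorsion (-(d:ℤ)) : ℂ) *
    (𝐞 ((d : ℝ) * ((r : ℝ) / 2 ^ k)) : ℂ) with hTdef
  set W : ℂ := ∑ d ∈ block n, ((quadFieldThreeTorsion (-(d:ℤ)) : ℂ) - 2) *
    (𝐞 ((d : ℝ) * ((r : ℝ) / 2 ^ k)) : ℂ) with hWdef
  have hcard : (0 : ℝ) ≤ ((block n).card : ℝ) := Nat.cast_nonneg _
  by_cases hk : k ≤ K
  · have h := hL k r hk1 hk hro hr
    have hkK : (k : ℝ) ≤ K := by exact_mod_cast hk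
    calc (k : ℝ) * ‖W‖ ≤ K * (ε / K * ((block n).card : ℝ)) :=
          mul_le_mul hkK h (norm_nonneg _) hKpos.le
      _ = ε * ((block n).card : ℝ) := by field_simp
  · have hk5 : 5 ≤ k := le_of_lt ((le_max_right K₀ 5).trans_lt (not_le.mp hk))
    have hkK₀ : K₀ ≤ k := le_of_lt ((le_max_left K₀ 5).trans_lt (not_le.mp hk))
    have hF' : (k : ℝ) * ‖F‖ ≤ ε / 3 * ((block n).card : ℝ) := hF k r hk5 hkn hro hr
    have hT' : (k : ℝ) * ‖T‖ ≤ ε / 3 * ((block n).card : ℝ) := hT k r hkK₀ hkn hro hr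
    have hk0 : (0 : ℝ) ≤ k := Nat.cast_nonneg _
    have hWTF : W = T - 2 * F := weylSum_eq n k r
    rw [hWTF]
    calc (k : ℝ) * ‖T - 2 * F‖
        ≤ (k : ℝ) * (‖T‖ + 2 * ‖F‖) := by
          gcongr
          calc ‖T - 2 * F‖ ≤ ‖T‖ + ‖2 * F‖ := norm_sub_le _ _
            _ = ‖T‖ + 2 * ‖F‖ := by rw [norm_mul, Complex.norm_ofNat]
      _ = (k : ℝ) * ‖T‖ + 2 * ((k : ℝ) * ‖F‖) := by ring
      _ ≤ ε / 3 * ((block n).card : ℝ) + 2 * (ε / 3 * ((block n).card : ℝ)) := by gcongr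
      _ = ε * ((block n).card : ℝ) := by ring

/-- The Walsh correlation, cast to `ℂ`, expanded in Weyl sums through the square-wave coefficients.
[folklore] -/
theorem walsh_eq_sum_weylSum {j : ℕ} {c : ℕ → ℂ}
    (hc : ∀ d : ℕ, ((walshSign j d : ℝ) : ℂ) =
      ∑ r ∈ Finset.range (2 ^ (j + 1)), c r * (𝐞 ((d : ℝ) * ((r : ℝ) / 2 ^ (j + 1))) : ℂ)) (n : ℕ) :
    ((walsh quadFieldThreeTorsion n j : ℝ) : ℂ) =
      ∑ r ∈ Finset.range (2 ^ (j + 1)), c r *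
        ∑ d ∈ block n, ((quadFieldThreeTorsion (-(d:ℤ)) : ℂ) - 2) *
          (𝐞 ((d : ℝ) * ((r : ℝ) / 2 ^ (j + 1))) : ℂ) := by
  unfold walsh
  push_cast
  simp_rw [hc, Finset.mul_sum]
  rw [Finset.sum_comm]
  refine Finset.sum_congr rfl fun r _ => Finset.sum_congr rfl fun d _ => ?_
  ring

/-- From the Fourier expansion and a uniform bound on the odd-frequency Weyl sums, a bound on the
Walsh correlation. [folklore] -/
theorem abs_walsh_le_of_weyl {j : ℕ} {c : ℕ → ℂ} {M B : ℝ} (hB : 0 ≤ B)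
    (hmass : (∑ r ∈ Finset.range (2 ^ (j + 1)), ‖c r‖) ≤ M)
    (hodd : ∀ r, ¬ Odd r → c r = 0)
    (hc : ∀ d : ℕ, ((walshSign j d : ℝ) : ℂ) =
      ∑ r ∈ Finset.range (2 ^ (j + 1)), c r * (𝐞 ((d : ℝ) * ((r : ℝ) / 2 ^ (j + 1))) : ℂ))
    (n : ℕ) (hW : ∀ r : ℕ, Odd r → r < 2 ^ (j + 1) →
      ‖∑ d ∈ block n, ((quadFieldThreeTorsion (-(d:ℤ)) : ℂ) - 2) *
          (𝐞 ((d : ℝ) * ((r : ℝ) / 2 ^ (j + 1))) : ℂ)‖ ≤ B) :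
    |walsh quadFieldThreeTorsion n j| ≤ M * B := by
  have h1 : |walsh quadFieldThreeTorsion n j| = ‖((walsh quadFieldThreeTorsion n j : ℝ) : ℂ)‖ := by
    rw [Complex.norm_real, Real.norm_eq_abs]
  rw [h1, walsh_eq_sum_weylSum hc n]
  calc ‖∑ r ∈ Finset.range (2 ^ (j + 1)), c r *
        ∑ d ∈ block n, ((quadFieldThreeTorsion (-(d:ℤ)) : ℂ) - 2) *
          (𝐞 ((d : ℝ) * ((r : ℝ) / 2 ^ (j + 1))) : ℂ)‖
      ≤ ∑ r ∈ Finset.range (2 ^ (j + 1)), ‖c r *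
        ∑ d ∈ block n, ((quadFieldThreeTorsion (-(d:ℤ)) : ℂ) - 2) *
          (𝐞 ((d : ℝ) * ((r : ℝ) / 2 ^ (j + 1))) : ℂ)‖ := norm_sum_le _ _
    _ ≤ ∑ r ∈ Finset.range (2 ^ (j + 1)), ‖c r‖ * B := by
        refine Finset.sum_le_sum fun r hr => ?_
        rw [norm_mul]
        by_cases hro : Odd r
        · exact mul_le_mul_of_nonneg_left (hW r hro (Finset.mem_range.mp hr)) (norm_nonneg _)
        · rw [hodd r hro, norm_zero, zero_mul, zero_mul]
    _ = (∑ r ∈ Finset.range (2 ^ (j + 1)), ‖c r‖) * B := by rw [Finset.sum_mul]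
    _ ≤ M * B := mul_le_mul_of_nonneg_right hmass hB

/-- **Composition, written out.** The six stubs give the crux from the route's support item
`EndJuntaRung` (`stub_btt` = the vendored named fact `btt_threeTorsion_sum`, consumed by `stub_high`). -/
theorem DigitRung_of' (hEJ : EndJuntaRung) : DigitRung := by
  have hbtt : btt_threeTorsion_sum := stub_btt
  rw [digitRung_iff_canonical, concl_iff_total_and_walsh]
  constructor
  · -- block mean: the top digit `j = n - 1`, `b = true`, selects the whole block
    intro ε hε
    filter_upwards [stub_high hbtt ε hε, eventually_ge_atTop 4] with n hn hn4
    have h := hn (n - 1) (by omega) (by omega) true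
    rwa [dev, half_pred_true (by omega)] at h
  · intro ε hε
    obtain ⟨A, hA⟩ := stub_fourier
    set A' : ℝ := max A 1 with hA'
    have hA'pos : 0 < A' := lt_of_lt_of_le one_pos (le_max_right _ _)
    have hAA' : A ≤ A' := le_max_left _ _
    filter_upwards [weyl_input hEJ (ε / A') (div_pos hε hA'pos),
      stub_high hbtt (ε / 2) (half_pos hε), eventually_ge_atTop 4] with n hW hH hn4 j hj
    by_cases hjn : 7 * n ≤ 10 * j
    · -- top digits: both halves are small, hence so is their difference
      rw [walsh_eq_dev_sub_dev]
      have h0 := hH j hj hjn false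
      have h1 := hH j hj hjn true
      calc |dev quadFieldThreeTorsion n j false - dev quadFieldThreeTorsion n j true|
          ≤ |dev quadFieldThreeTorsion n j false| + |dev quadFieldThreeTorsion n j true| :=
            abs_sub _ _
        _ ≤ ε / 2 * ((block n).card : ℝ) + ε / 2 * ((block n).card : ℝ) := add_le_add h0 h1
        _ = ε * ((block n).card : ℝ) := by ring
    · -- the remaining digits: Fourier expansion + Weyl input at depth `k = j + 1`
      push Not at hjn
      obtain ⟨c, hmass, hodd, hc⟩ := hA j
      have hcard : (0 : ℝ) ≤ ((block n).card : ℝ) := Nat.cast_nonneg _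
      have hB : ∀ r : ℕ, Odd r → r < 2 ^ (j + 1) →
          ‖∑ d ∈ block n, ((quadFieldThreeTorsion (-(d:ℤ)) : ℂ) - 2) *
              (𝐞 ((d : ℝ) * ((r : ℝ) / 2 ^ (j + 1))) : ℂ)‖ ≤
            ε / A' * ((block n).card : ℝ) / (j + 1) := by
        intro r hro hr
        have h := hW (j + 1) r (by omega) (by omega) hro hr
        rw [le_div_iff₀ (by positivity)]
        rw [mul_comm] at h
        exact_mod_cast h
      have hmass' : (∑ r ∈ Finset.range (2 ^ (j + 1)), ‖c r‖) ≤ A' * (j + 1) :=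
        hmass.trans (mul_le_mul_of_nonneg_right hAA' (by positivity))
      calc |walsh quadFieldThreeTorsion n j|
          ≤ A' * (j + 1) * (ε / A' * ((block n).card : ℝ) / (j + 1)) :=
            abs_walsh_le_of_weyl (by positivity) hmass' hodd hc n hB
        _ = ε * ((block n).card : ℝ) := by
            field_simp

end Summit.QuantumAdvantage.DigitRung.Sketch

end
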